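import Summits.QuantumFields.YangMills.Theorems.AlphaInputsT3ACv3AdaptedClassR
import HarnessLib

/-!
# `AlphaInputsT3ACv3Reg68LocalOfRegions` — (O″χ) block B1, plumbing row **r-68a**: **THE READ-LOCAL (68) SET FROM (2)∕(8)-REGULARITY ON THE REGIONS** — a finest field `U` whose
# plaquettes inside `Ω_j(h)` are within `ρ_j·L^{−2j}` of `1` for every `j < k` (the multi-region regularity (2) of [Balaban1985Variational], the radius (8) of its Theorem 1, in
# the cell's T³ letters `plaqsIn 0 (Omega M₁ Rcol k h j)` ∕ `dist1 (plaqHol U q)`) lies in `reg68LocalSet F 𝔠 γ hγ hγ1 K k h` as soon as `ρ_j ≤ ½C68·g_j p(g_j)` — at every ADMISSIBLE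
# history — lane `pub-balaban3d` ∕ cell `ym3-torus`, width seat `ym-ust-19936-w2` (g3)

WHY (LEAD ★w1-19936 g3 B1 memo `B1-REGIONAL-THM1-LOCATE-w1-g3.md` 684417eece222bc3 §1 row r-68a; ★★OWNER ym3-torus-plan g26 RULING g26-№8 (3), 2026-08-28T07:01:28Z «r-68a ★w2-19936 g3
GO in the ABSTRACT currency `hU2 : ∀ j ≤ k, ∀ q ∈ plaqsIn 0 (Omega M₁ Rcol k h j), dist1 (plaqHol U q) ≤ ρ j·((F.L:ℝ)^j)⁻²`, `hρ : ρ j ≤ 𝔠.C68∕2·(g_j·p(g_j))`»).  The B1 block of NODE O's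
(O″χ) bill asks that print's (42)-minimiser lie in the selection class `𝒞_X(k,h,W)`; its conjunct `reg68LocalSet` (the half-constant, read-local form of row `h68`: `pdevOn` on the box
under every RECORDED plaquette `(j, p′) ∈ disc h` of the LIFTED configuration is `≤ ½C68·g_j p(g_j)·L^{−2j}`) is, for print's minimiser, the radius (8) of Theorem 1 read on
`Ω_j(h) ⊇ Λ_j(h) ⊇ P_j(h)`.  THIS FILE is the dictionary step, ONCE, with the regional regularity DISPLAYED as a hypothesis in T³ letters (so it does not wait for the regional
carrier `famRegT3`): the box `[loK, plaqHiK]` under `p′` is the union of the four `j`-blocks at its corners, every fine plaquette INSIDE that box (`PlaqIn`: lower and upper corner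
in the box, hence all four corners) projects to a torus plaquette whose four corners lie in `plaqCover p′ ⊆ Ω_j(h)` (✓ `plaqCover_subset_of_admissible`, admissibility), i.e. to a
member of `plaqsIn 0 (Ω_j(h))`; the lift's plaquette holonomy there is `ρ` of the torus plaquette variable (✓ `norm_hol_liftCfg_sub_one`), in either orientation (`plaqVar` =
`plaqHol` or its inverse, `dist1_inv`).
WHAT (def-free).  §0 `AlphaInputsT3AC.pdevOn_le_of_forall_plaqIn` (a `pdevOn` bound from a bound on the plaquettes INSIDE the box — the `PlaqIn` twin of ✓ `pdevOn_le_of_forall_ne`),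
`inBox_add_e_of_plaqIn` (the two middle corners are in the box), `plaqVar_swap` ∕ `dist1_plaqVar_le_of_plaqHol` (orientation); §1 ★★ `AlphaInputsT3AC.mem_reg68LocalSet_of_regionRegular`
(`j < k` form) and ★ `…_of_regionRegular_le` (the recorded `j ≤ k` form).
HONEST FRAMING.  Lattice bookkeeping over NODE O's letters; the regional regularity of print's minimiser (Theorem 1 (8) at the regional family) is a HYPOTHESIS here, not proved;
nothing of B1, the stub `stub_laneRecordsV3Chi`, the crux `HistoryTailL` or a gap is closed; count-neutral helper (`--supports stmt-QuantumFields-19936`); registry untouched.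
YM₃ on the three-torus is rung R3 of the programme, not the Clay problem: nothing here is about d = 4, infinite volume, or a mass gap.

References: T. Bałaban, Commun. Math. Phys. 102 (1985) 255–275 [Balaban1985UV3] ((38)–(42) p.266, (68) p.273); Commun. Math. Phys. 102 (1985) 277–309 [Balaban1985Variational]
((2) p.278, Thm 1 (8) p.279); Commun. Math. Phys. 98 (1985) 17–51 [Balaban1985Averaging] ((9) p.18, (44) p.24, (46)+(52) pp.25–26).
-/

set_option autoImplicit false

noncomputable section

namespace Summit.QuantumFields.YangMills.Theorems

open MeasureTheory Set
open scoped Matrix Matrix.Norms.L2Operator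
open Literature.MathematicalPhysics.QuantumFieldTheory.Balaban1983to89
open Literature.MathematicalPhysics.QuantumFieldTheory.Balaban1983to89.B10 (pFun)
open Literature.MathematicalPhysics.QuantumFieldTheory.Balaban1983to89.T3ContinuumYM3Torus
open Literature.MathematicalPhysics.QuantumFieldTheory.Balaban1983to89.B10Eq38TorusDomains (plaqsIn mem_plaqsIn_iff cornerSet toFine toFine_zero)
open Literature.MathematicalPhysics.QuantumFieldTheory.Balaban1985CMP102.Setting
open Summit.QuantumFields.Balaban3D.Carriers
open Summit.QuantumFields.Balaban3D.Proofs.Primitives (AlphaConsts)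
open Summit.QuantumFields.Balaban3D.Proofs.LiftBridge (liftCfg)
open Summit.QuantumFields.Balaban3D.Proofs.TorusLift (projSite zOf projSite_mem_plaqCover projSite_add_e)
open Summit.QuantumFields.Balaban3D.Proofs.AdmissibleRegions (plaqCover_subset_of_admissible)
open Summit.QuantumFields.Balaban3D.Proofs.Run3SmallFactors (codeZ decode_of_mem_disc)
open Summit.QuantumFields.Balaban3D.Proofs.ScalesArithmetic (gk_pos gk_le_one)
open Summit.QuantumFields.Balaban3D.Proofs.CouplingWindow (pFun_pos)
open Summit.QuantumFields.YangMills.Theorems.BalabanUVNodesN08AlphaClassIDischarge (mem_deltaBox_of_inBox)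
open Summit.QuantumFields.YangMills.Theorems.BalabanUVNodesN08AlphaRegSel (plaqVar norm_hol_liftCfg_sub_one)
open B7Prop1Explicit (hol plaqWord e e_apply)
open B7Prop1Local (pdevOn loK plaqHiK InBox PlaqIn)
open B7Prop2Explicit (hol_plaqWord_self)

/-! ## §0 Three pieces of bookkeeping: `pdevOn` from the plaquettes inside the box; the middle corners; orientation -/

/-- **A `pdevOn` BOUND FROM A BOUND ON EVERY NON-DEGENERATE PLAQUETTE INSIDE THE BOX** (`PlaqIn`: lower AND upper corner in the box — the twin of ✓ `ReadLocal.pdevOn_le_of_forall_ne`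
keeping the upper-corner premise). [cite: Balaban1985Averaging, (44) p.24, (52) p.26] -/
theorem AlphaInputsT3AC.pdevOn_le_of_forall_plaqIn {𝔸 : Type*} [NormedRing 𝔸] [NormOneClass 𝔸] {d : ℕ} {lo hi : B7Prop1Explicit.Site d}
    {V : B7Prop1Explicit.Site d → Fin d → 𝔸ˣ} {b : ℝ} (hb : 0 ≤ b)
    (h : ∀ (x : B7Prop1Explicit.Site d) (μ ν : Fin d), μ ≠ ν → InBox lo hi x → InBox lo hi (x + e μ + e ν) →
      ‖((hol V x (plaqWord μ ν) : 𝔸ˣ) : 𝔸) - 1‖ ≤ b) :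
    pdevOn lo hi V ≤ b := by
  refine Real.iSup_le (fun p => ?_) hb
  obtain ⟨⟨x, μ, ν⟩, hp⟩ := p
  rcases eq_or_ne μ ν with rfl | hμν
  · show ‖((hol V x (plaqWord μ μ) : 𝔸ˣ) : 𝔸) - 1‖ ≤ b
    rw [hol_plaqWord_self, Units.val_one, sub_self, norm_zero]; exact hb
  · exact h x μ ν hμν hp.1 hp.2

/-- **THE TWO MIDDLE CORNERS OF A PLAQUETTE INSIDE A BOX ARE INSIDE THE BOX** (every coordinate of `x + e_μ`, `x + e_ν` lies between those of `x` and of `x + e_μ + e_ν`). [folklore] -/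
theorem AlphaInputsT3AC.inBox_add_e_of_plaqIn {d : ℕ} {lo hi x : B7Prop1Explicit.Site d} {μ ν : Fin d}
    (hx : InBox lo hi x) (hx2 : InBox lo hi (x + e μ + e ν)) : InBox lo hi (x + e μ) ∧ InBox lo hi (x + e ν) := by
  refine ⟨fun i => ?_, fun i => ?_⟩
  all_goals
    obtain ⟨h1a, h1b⟩ := hx i
    obtain ⟨h2a, h2b⟩ := hx2 i
    simp only [Pi.add_apply, e_apply] at h2a h2b ⊢
    split_ifs at h2a h2b ⊢ <;> constructor <;> omega

section Orientation

variable {L : ℕ} {S : Scales L} {G : Type} [GaugeGroup G]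

/-- **ORIENTATION**: the torus plaquette variable in the reversed order is the inverse. [cite: Balaban1985Averaging, (9) p.18] -/
theorem AlphaInputsT3AC.plaqVar_swap (U : GaugeField S.P 0 G) (y : Site S.P 0) (μ ν : Fin S.P.d) :
    plaqVar U y ν μ = (plaqVar U y μ ν)⁻¹ := by
  simp only [plaqVar, mul_inv_rev, inv_inv, mul_assoc]

/-- **THE PLAQUETTE VARIABLE IN EITHER ORIENTATION IS CONTROLLED BY THE ORDERED PLAQUETTE HOLONOMIES AT THE SAME CORNER** (`plaqVar = plaqHol` for `μ < ν`, its inverse for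
`ν < μ`; `dist1` is inversion-invariant). [cite: Balaban1985Averaging, (9) p.18] -/
theorem AlphaInputsT3AC.dist1_plaqVar_le_of_plaqHol (U : GaugeField S.P 0 G) (y : Site S.P 0) {μ ν : Fin S.P.d} (hμν : μ ≠ ν) {c : ℝ}
    (h : ∀ (a b : Fin S.P.d) (hab : a < b), (a = μ ∧ b = ν) ∨ (a = ν ∧ b = μ) → GaugeGroup.dist1 (GaugeField.plaqHol U ⟨y, a, b, hab⟩) ≤ c) :
    GaugeGroup.dist1 (plaqVar U y μ ν) ≤ c := by
  rcases lt_or_gt_of_ne hμν with hlt | hlt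
  · exact h μ ν hlt (Or.inl ⟨rfl, rfl⟩)
  · rw [show plaqVar U y μ ν = (plaqVar U y ν μ)⁻¹ from AlphaInputsT3AC.plaqVar_swap U y ν μ, GaugeGroup.dist1_inv]
    exact h ν μ hlt (Or.inr ⟨rfl, rfl⟩)

end Orientation

/-! ## §1 r-68a: regional (2)∕(8)-regularity ⇒ the read-local (68) set -/

section T3

variable {F : T3Family} {𝔠 : AlphaConsts F.L (suGroupModel 2).N} {γ : ℝ} {hγ : 0 < γ} {hγ1 : γ ≤ (min 𝔠.gamma0 1) ^ 2} {K : ℕ}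

/-- **★★ r-68a: THE READ-LOCAL (68) SET FROM REGIONAL REGULARITY** (`k ≤ K`, `h` admissible).  HYPOTHESES (displayed; for print's (42)-minimiser they are [Balaban1985Variational] Thm 1
(8) = (2) at radius `B₃ε₁` on the regions, plus the record window): `hU2` — for every `j < k`, every finest plaquette with all four corners in `Ω_j(h)` has `dist1 U(∂q) ≤ ρ_j·L^{−2j}`;
`hρ` — `ρ_j ≤ ½C68·g_j p(g_j)`.  CONCLUSION: `U ∈ reg68LocalSet F 𝔠 γ hγ hγ1 K k h`.  For a recorded `(j, p′) ∈ disc h` the box under `p′` projects into `plaqCover p′ ⊆ Ω_j(h)`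
(`plaqCover_subset_of_admissible`), so every plaquette inside it is a member of `plaqsIn 0 (Ω_j(h))` and `pdevOn ≤ ρ_j·L^{−2j} ≤ ½C68·g_j p(g_j)·L^{−2j}`.
[cite: Balaban1985UV3, (68) p.273, (38)–(42) p.266; Balaban1985Variational, (2) p.278, Thm 1 (8) p.279] -/
theorem AlphaInputsT3AC.mem_reg68LocalSet_of_regionRegular {k : ℕ} (hk : k ≤ K) {h : Hist (F.P K) k}
    (hh : Hist.Admissible 𝔠.lane.carrier.M₁ (rcolOf (T3Scales F γ hγ (hγ1.trans (sq_min_one_le _ 𝔠.gamma0_pos)) K) 𝔠.lane.carrier) k h)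
    {U : GaugeField (F.P K) 0 (Matrix.specialUnitaryGroup (Fin 2) ℂ)} {ρ : ℕ → ℝ}
    (hU2 : ∀ j, j < k → ∀ q : Plaq (F.P K) 0,
      q ∈ plaqsIn 0 (Omega 𝔠.lane.carrier.M₁ (rcolOf (T3Scales F γ hγ (hγ1.trans (sq_min_one_le _ 𝔠.gamma0_pos)) K) 𝔠.lane.carrier) k h j) →
        GaugeGroup.dist1 (GaugeField.plaqHol U q) ≤ ρ j * (((F.L : ℝ) ^ j)⁻¹) ^ 2)
    (hρ : ∀ j, j < k → ρ j ≤ 𝔠.C68 / 2 * ((T3Scales F γ hγ (hγ1.trans (sq_min_one_le _ 𝔠.gamma0_pos)) K).gk j *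
      pFun 𝔠.lane.carrier.b₀ 𝔠.lane.carrier.p₀ ((T3Scales F γ hγ (hγ1.trans (sq_min_one_le _ 𝔠.gamma0_pos)) K).gk j))) :
    U ∈ AlphaInputsT3AC.reg68LocalSet F 𝔠 γ hγ hγ1 K k h := by
  intro q hq
  set S : Scales F.L := T3Scales F γ hγ (hγ1.trans (sq_min_one_le _ 𝔠.gamma0_pos)) K with hS
  obtain ⟨j, hj, p, hp, hqj, hz, hμ, hν⟩ := decode_of_mem_disc (S := S) hq
  have hq1 : q.1 = j := by rw [hqj]
  rw [hq1, hz, hμ, hν]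
  have hjm : j ≤ S.P.m + S.P.K := by show j ≤ F.m + K; omega
  have hgj : 0 < S.gk j := gk_pos S j
  have hLj : (0 : ℝ) ≤ (((F.L : ℝ) ^ j)⁻¹) ^ 2 := sq_nonneg _
  have hc : 0 ≤ 𝔠.C68 / 2 * (S.gk j * pFun 𝔠.lane.carrier.b₀ 𝔠.lane.carrier.p₀ (S.gk j)) * (((F.L : ℝ) ^ j)⁻¹) ^ 2 := by
    have := 𝔠.C68_pos
    have hp : 0 < pFun 𝔠.lane.carrier.b₀ 𝔠.lane.carrier.p₀ (S.gk j) := pFun_pos _ _ _ 𝔠.b₀_pos hgj (gk_le_one S S.gK_le_one j (by show j ≤ K; omega))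
    positivity
  -- every site of the box under `p′` projects into `plaqCover p′ ⊆ Ω_j(h)`
  have hΩ : ∀ y : B7Prop1Explicit.Site S.P.d, InBox (loK F.L j (zOf p)) (plaqHiK F.L j (zOf p) p.μ p.ν) y →
      projSite y ∈ Omega 𝔠.lane.carrier.M₁ (rcolOf S 𝔠.lane.carrier) k h j := fun y hy =>
    (plaqCover_subset_of_admissible 𝔠.lane.carrier.M₁ (rcolOf S 𝔠.lane.carrier) hh hj hp
      (projSite_mem_plaqCover hjm p (mem_deltaBox_of_inBox S.P.L j (zOf p) p.μ p.ν hy))).1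
  haveI : NeZero (suGroupModel 2).N := ⟨Nat.pos_iff_ne_zero.mp (suGroupModel 2).N_pos⟩
  letI : CStarAlgebra (Matrix (Fin (suGroupModel 2).N) (Fin (suGroupModel 2).N) ℂ) := {}
  refine AlphaInputsT3AC.pdevOn_le_of_forall_plaqIn hc fun x μ ν hμν hx hx2 => ?_
  rw [norm_hol_liftCfg_sub_one]
  obtain ⟨hxμ, hxν⟩ := AlphaInputsT3AC.inBox_add_e_of_plaqIn hx hx2
  -- the four corners of the projected plaquette lie in `Ω_j(h)`
  have c0 := hΩ x hx
  have cμ : (projSite x).shift μ ∈ Omega 𝔠.lane.carrier.M₁ (rcolOf S 𝔠.lane.carrier) k h j := by rw [← projSite_add_e]; exact hΩ _ hxμ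
  have cν : (projSite x).shift ν ∈ Omega 𝔠.lane.carrier.M₁ (rcolOf S 𝔠.lane.carrier) k h j := by rw [← projSite_add_e]; exact hΩ _ hxν
  have cμν : ((projSite x).shift μ).shift ν ∈ Omega 𝔠.lane.carrier.M₁ (rcolOf S 𝔠.lane.carrier) k h j := by
    rw [← projSite_add_e, ← projSite_add_e]; exact hΩ _ hx2
  have cνμ : ((projSite x).shift ν).shift μ ∈ Omega 𝔠.lane.carrier.M₁ (rcolOf S 𝔠.lane.carrier) k h j := by
    rw [← projSite_add_e, ← projSite_add_e, add_right_comm]; exact hΩ _ hx2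
  refine (AlphaInputsT3AC.dist1_plaqVar_le_of_plaqHol (S := S) U (projSite x) hμν fun a b hab hor => ?_).trans
    (mul_le_mul_of_nonneg_right (hρ j hj) hLj)
  refine hU2 j hj ⟨projSite x, a, b, hab⟩ (mem_plaqsIn_iff.mpr ?_)
  intro y hy
  simp only [cornerSet, Set.mem_insert_iff, Set.mem_singleton_iff, toFine_zero] at hy
  rcases hor with ⟨rfl, rfl⟩ | ⟨rfl, rfl⟩
  · rcases hy with rfl | rfl | rfl | rfl
    exacts [c0, cμ, cν, cμν]
  · rcases hy with rfl | rfl | rfl | rfl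
    exacts [c0, cν, cμ, cνμ]

/-- **★ r-68a IN THE RECORDED SHAPE** (`j ≤ k` quantifiers, as in ★★OWNER g26 RULING g26-№8 (3)): same conclusion from the regional regularity stated for all `j ≤ k`.
[cite: Balaban1985UV3, (68) p.273; Balaban1985Variational, (2) p.278, Thm 1 (8) p.279] -/
theorem AlphaInputsT3AC.mem_reg68LocalSet_of_regionRegular_le {k : ℕ} (hk : k ≤ K) {h : Hist (F.P K) k}
    (hh : Hist.Admissible 𝔠.lane.carrier.M₁ (rcolOf (T3Scales F γ hγ (hγ1.trans (sq_min_one_le _ 𝔠.gamma0_pos)) K) 𝔠.lane.carrier) k h)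
    {U : GaugeField (F.P K) 0 (Matrix.specialUnitaryGroup (Fin 2) ℂ)} {ρ : ℕ → ℝ}
    (hU2 : ∀ j, j ≤ k → ∀ q : Plaq (F.P K) 0,
      q ∈ plaqsIn 0 (Omega 𝔠.lane.carrier.M₁ (rcolOf (T3Scales F γ hγ (hγ1.trans (sq_min_one_le _ 𝔠.gamma0_pos)) K) 𝔠.lane.carrier) k h j) →
        GaugeGroup.dist1 (GaugeField.plaqHol U q) ≤ ρ j * (((F.L : ℝ) ^ j)⁻¹) ^ 2)
    (hρ : ∀ j, j ≤ k → ρ j ≤ 𝔠.C68 / 2 * ((T3Scales F γ hγ (hγ1.trans (sq_min_one_le _ 𝔠.gamma0_pos)) K).gk j *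
      pFun 𝔠.lane.carrier.b₀ 𝔠.lane.carrier.p₀ ((T3Scales F γ hγ (hγ1.trans (sq_min_one_le _ 𝔠.gamma0_pos)) K).gk j))) :
    U ∈ AlphaInputsT3AC.reg68LocalSet F 𝔠 γ hγ hγ1 K k h :=
  AlphaInputsT3AC.mem_reg68LocalSet_of_regionRegular (hγ1 := hγ1) hk hh (fun j hj => hU2 j hj.le) (fun j hj => hρ j hj.le)

end T3

end Summit.QuantumFields.YangMills.Theorems

end
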